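import Mathlib
import Summits.RiemannHypothesis.RiemannHypothesis.Theorems.WeilFarFloorCoshCouplingRH
import Summits.RiemannHypothesis.RiemannHypothesis.Theorems.WeilFarFloorCoshQuotientContinuity
import HarnessLib

/-!
# Under RH the cosh quotient is `e^b − O(b³)`; the weight sum of a window

Helper file (`--supports stmt-RiemannHypothesis-0098`, lead-track anchor: Weil-positivity window ladder, format-C far bound),
pure proofs.  Seat rh-explicit-weil-1 gen13 (memo `run/shared/lean/pub/rh-explicit/rh-explicit-weil-1/FORMAT-K3.md` §14):
two scalar ingredients of the C-XIII″ assembly («under RH the cosh test is asymptotically THE extremal»,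
`WeilFarFloorCoshOptimalRH`).

§1 `integral_inv_mul_psi_ge_of_vonKoch`: from a von Koch bound `|ψ(y) − y| ≤ K√y·log²y + M` (`y ≥ 1`),
`∫_{(1,X]} ψ(t)dt/t ≥ X − 1 − (K√X·log²X + M)·log X` (`X ≥ 1`).
§2 `primeShiftForm_coshTest_ge_of_RH`: **`RH → ∃ C ≥ 0, ∀ b ≥ 1, (e^b − C(b³ + 1))·(b + sinh b) ≤ Q_b(χ_b)`**, i.e. the cosh quotient
`R_c(b) = Q_b(χ_b)/(b + sinh b)` is `≥ e^b − C(b³ + 1)` (`coshQuotient_ge_of_RH`); from the closed form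
`Q_b(χ_b) = e^b·Σ_{n≤e^{2b}}Λ/n − e^{−b}ψ(e^{2b}) + ½ΣΛ(n)(2b − log n)(1 + 1/n)` (`FloorCosh.primeShiftForm_coshTest`), Mertens from below
(`Σ_{n≤x}Λ/n ≥ log x − 4`), Abel (`ΣΛ(n)log(X/n) = ∫₁^Xψ/t`) and von Koch under RH (`exists_abs_psi_sub_le_of_RH`).  [In the C-XIII″ assembly
this polynomial accuracy makes the deficit of a near-extremal below the RH ceiling `O(b³)`, so that the profile rigidity
(`WeilFarFloorProfileRigidityRH`, slope `≍ e^b`) forces its residual to be `O(b³e^{−b})` in energy.]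
§3 `weightSum_le`: `Σ_{log n<2a} 2Λ(n)/√n ≤ 38(e^a + 1)` (`FloorGrowth.sum_vonMangoldt_div_sqrt_le`).
Standard axioms only; RH enters as Mathlib's `RiemannHypothesis`.
-/

set_option linter.dupNamespace false
set_option autoImplicit false

noncomputable section

open MeasureTheory Set Filter
open scoped Real Topology ArithmeticFunction.vonMangoldt Chebyshev

namespace Summit.RiemannHypothesis.RiemannHypothesis.Theorems.WeilFormatC

namespace FloorCoshSplit

open Literature.NumberTheory.LFunctions FloorCosh

variable {b : ℝ}

/-! ## §1 The log-Riesz mean of `ψ` under a von Koch bound -/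

/-- From `|ψ(y) − y| ≤ K√y·log²y + M` for `y ≥ 1`: `X − 1 − (K√X·log²X + M)·log X ≤ ∫_{(1,X]} ψ(t)dt/t` (`X ≥ 1`). -/
theorem integral_inv_mul_psi_ge_of_vonKoch {K M X : ℝ} (hK : 0 ≤ K) (hX : 1 ≤ X)
    (hvk : ∀ y : ℝ, 1 ≤ y → |ψ y - y| ≤ K * Real.sqrt y * Real.log y ^ 2 + M) :
    X - 1 - (K * Real.sqrt X * Real.log X ^ 2 + M) * Real.log X ≤ ∫ t in Ioc 1 X, t⁻¹ * ψ t := by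
  set E := K * Real.sqrt X * Real.log X ^ 2 + M with hE
  have hlogX : 0 ≤ Real.log X := Real.log_nonneg hX
  have hcont : ContinuousOn (fun t : ℝ ↦ 1 - E * t⁻¹) (Icc 1 X) := by
    have hinv : ContinuousOn (fun t : ℝ ↦ t⁻¹) (Icc 1 X) :=
      continuousOn_inv₀.mono fun t ht ↦ by simp only [mem_compl_iff, mem_singleton_iff]; linarith [ht.1]
    exact continuousOn_const.sub (continuousOn_const.mul hinv)
  have hle : ∫ t in Ioc 1 X, (1 - E * t⁻¹) ≤ ∫ t in Ioc 1 X, t⁻¹ * ψ t := by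
    refine setIntegral_mono_on (hcont.integrableOn_Icc.mono_set Ioc_subset_Icc_self)
      (integrableOn_inv_mul_psi X) measurableSet_Ioc fun t ht ↦ ?_
    have ht1 : 1 ≤ t := ht.1.le
    have ht0 : 0 < t := by linarith
    have h1 := (abs_le.1 (hvk t ht1)).1
    have hlogt : 0 ≤ Real.log t := Real.log_nonneg ht1
    have hlog : Real.log t ≤ Real.log X := Real.log_le_log ht0 ht.2
    have hsq : Real.log t ^ 2 ≤ Real.log X ^ 2 := pow_le_pow_left₀ hlogt hlog 2
    have hsqrt : Real.sqrt t ≤ Real.sqrt X := Real.sqrt_le_sqrt ht.2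
    have hmono : K * Real.sqrt t * Real.log t ^ 2 + M ≤ E := by
      rw [hE]
      have := mul_le_mul (mul_le_mul_of_nonneg_left hsqrt hK) hsq (sq_nonneg _) (by positivity)
      linarith
    rw [show 1 - E * t⁻¹ = t⁻¹ * (t - E) by field_simp]
    exact mul_le_mul_of_nonneg_left (by linarith) (inv_nonneg.2 ht0.le)
  refine le_trans ?_ hle
  have hderiv : ∀ t ∈ uIcc 1 X, HasDerivAt (fun t : ℝ ↦ t - E * Real.log t) (1 - E * t⁻¹) t := by
    intro t ht
    rw [uIcc_of_le hX] at ht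
    have ht0 : t ≠ 0 := by linarith [ht.1]
    exact (hasDerivAt_id t).sub ((Real.hasDerivAt_log ht0).const_mul E)
  rw [← intervalIntegral.integral_of_le hX, intervalIntegral.integral_eq_sub_of_hasDerivAt hderiv
    ((hcont.mono (by rw [uIcc_of_le hX])).intervalIntegrable)]
  simp only [Real.log_one, mul_zero, sub_zero]
  linarith

/-! ## §2 Under RH: the cosh quotient from below to polynomial accuracy -/

/-- **UNDER RH: `Q_b(χ_b) ≥ (e^b − C(b³ + 1))·(b + sinh b)`** for all `b ≥ 1`, for some absolute `C ≥ 0`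
(`χ_b = cosh(·/2)·1_{[−b,b]}`, `∫χ_b² = b + sinh b`). -/
theorem primeShiftForm_coshTest_ge_of_RH (hRH : RiemannHypothesis) :
    ∃ C : ℝ, 0 ≤ C ∧ ∀ b : ℝ, 1 ≤ b →
      (Real.exp b - C * (b ^ 3 + 1)) * (b + Real.sinh b)
        ≤ primeShiftForm b ((Icc (-b) b).indicator (fun y ↦ Real.cosh (y / 2))) := by
  obtain ⟨K, M, hK, hM, hvk⟩ := exists_abs_psi_sub_le_of_RH hRH
  refine ⟨16 * K + 2 * M + 14, by positivity, fun b hb ↦ ?_⟩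
  set C := 16 * K + 2 * M + 14 with hC
  have hb0 : 0 ≤ b := by linarith
  -- nonnegativity of `Q_b(χ_b)` (monotone from `Q_0(χ_0) = 0`)
  have hQ0 : 0 ≤ primeShiftForm b ((Icc (-b) b).indicator (fun y ↦ Real.cosh (y / 2))) := by
    obtain ⟨h, -⟩ := primeShiftForm_coshTest_sub_nonneg_le (a := 0) (a' := b) le_rfl hb0
    have hz : primeShiftForm 0 ((Icc (-(0 : ℝ)) 0).indicator (fun y ↦ Real.cosh (y / 2))) = 0 := by
      rw [primeShiftForm_coshTest]; simp
    linarith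
  set E := Real.exp b with hEdef
  have hEpos : 0 < E := Real.exp_pos b
  have hE1b : b + 1 ≤ E := by rw [hEdef]; linarith [Real.add_one_le_exp b]
  have hsinh : Real.sinh b ≤ E / 2 := by rw [Real.sinh_eq]; linarith [Real.exp_pos (-b)]
  have hP0 : 0 < b + Real.sinh b := by have := Real.sinh_pos_iff.2 (by linarith : 0 < b); linarith
  -- polynomial bookkeeping, done before the big sums enter the context: `C(b³+1) ≥ (16K+2)b³ + (2M+12)`
  have hb3 : 1 ≤ b ^ 3 := one_le_pow₀ hb
  have hCD : 0 ≤ C * (b ^ 3 + 1) := by positivity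
  have hC1 : (16 * K + 2) * b ^ 3 + (2 * M + 12) ≤ C * (b ^ 3 + 1) := by
    rw [hC]; nlinarith only [hK, hM, hb3]
  have p0 : C * (b ^ 3 + 1) * b ≥ 0 := mul_nonneg hCD hb0
  have p1 : 16 * (K * b ^ 3 * E) + 2 * (b ^ 3 * E) + 2 * (M * E) + 12 * E ≤ C * (b ^ 3 + 1) * E := by
    have := mul_le_mul_of_nonneg_right hC1 hEpos.le
    linarith only [this]
  have p2 : K * b ^ 2 ≤ K * b ^ 3 * E := by
    have h1 : b ^ 2 ≤ b ^ 3 * E := by nlinarith only [hb, hb3, hE1b]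
    nlinarith only [hK, h1]
  have p3 : M + M * b ≤ M * E := by nlinarith only [hM, hE1b]
  have p4 : 1 ≤ b ^ 3 * E := by nlinarith only [hb3, hE1b, hb]
  have p5 : 0 ≤ E * b := mul_nonneg hEpos.le hb0
  -- trivial case: a negative factor
  by_cases hneg : Real.exp b - C * (b ^ 3 + 1) < 0
  · exact le_trans (mul_nonpos_of_nonpos_of_nonneg hneg.le hP0.le |>.trans le_rfl) hQ0
  push Not at hneg
  -- main case: compare with `(e^b − C(b³+1))·(b + e^b/2)`
  have hstep : (E - C * (b ^ 3 + 1)) * (b + Real.sinh b) ≤ (E - C * (b ^ 3 + 1)) * (b + E / 2) :=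
    mul_le_mul_of_nonneg_left (by linarith) hneg
  refine hstep.trans ?_
  rw [primeShiftForm_coshTest b]
  -- the closed form split into three sums
  set X := ⌊Real.exp (2 * b)⌋₊ with hX
  have hE2 : Real.exp (2 * b) = E ^ 2 := by rw [hEdef, ← Real.exp_nat_mul]; norm_num
  have hX1 : 1 ≤ Real.exp (2 * b) := Real.one_le_exp (by linarith)
  have hEinv : Real.exp (-b) * E = 1 := by rw [hEdef, ← Real.exp_add]; simp
  have hEinv0 : 0 < Real.exp (-b) := Real.exp_pos _
  have hEinv1 : Real.exp (-b) ≤ 1 := Real.exp_le_one_iff.2 (by linarith)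
  have hsplit : ∑ n ∈ Finset.Ioc 0 X, (Λ n : ℝ) * (E / n - Real.exp (-b) + (2 * b - Real.log n) * (1 + 1 / n) / 2)
      = E * (∑ n ∈ Finset.Ioc 0 X, (Λ n : ℝ) / n) - Real.exp (-b) * (∑ n ∈ Finset.Ioc 0 X, (Λ n : ℝ))
        + ∑ n ∈ Finset.Ioc 0 X, (Λ n : ℝ) * ((2 * b - Real.log n) * (1 + 1 / n) / 2) := by
    rw [Finset.mul_sum, Finset.mul_sum, ← Finset.sum_sub_distrib, ← Finset.sum_add_distrib]
    refine Finset.sum_congr rfl fun n _ ↦ ?_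
    ring
  rw [hsplit]
  -- (i) Mertens from below
  have hMer : 2 * b - 4 ≤ ∑ n ∈ Finset.Ioc 0 X, (Λ n : ℝ) / n := by
    have h := vonMangoldt_div_sum_ge hX1
    rwa [Real.log_exp] at h
  -- (ii) von Koch from above for `ψ(e^{2b})`
  have hψ : ∑ n ∈ Finset.Ioc 0 X, (Λ n : ℝ) ≤ E ^ 2 + K * E * (2 * b) ^ 2 + M := by
    have hψX : ψ (Real.exp (2 * b)) = ∑ n ∈ Finset.Ioc 0 X, (Λ n : ℝ) := rfl
    have h := (abs_le.1 (hvk _ hX1)).2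
    rw [hψX, Real.log_exp, hE2, Real.sqrt_sq hEpos.le] at h
    linarith
  -- (iii) the weighted sum via Abel + von Koch from below
  have hW : (E ^ 2 - 1 - (K * E * (2 * b) ^ 2 + M) * (2 * b)) / 2
      ≤ ∑ n ∈ Finset.Ioc 0 X, (Λ n : ℝ) * ((2 * b - Real.log n) * (1 + 1 / n) / 2) := by
    have hI := integral_inv_mul_psi_ge_of_vonKoch (X := Real.exp (2 * b)) hK hX1 hvk
    rw [← sum_vonMangoldt_mul_log_div_eq_integral, Real.log_exp, ← hX, hE2, Real.sqrt_sq hEpos.le] at hI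
    have hdrop : ∑ n ∈ Finset.Icc 0 X, (2 * b - Real.log n) * (Λ n : ℝ)
        = ∑ n ∈ Finset.Ioc 0 X, (2 * b - Real.log n) * (Λ n : ℝ) := by
      rw [← Finset.sum_subset (Finset.Ioc_subset_Icc_self) fun n hn hn' ↦ by
        have h0 : n = 0 := by rw [Finset.mem_Icc] at hn; rw [Finset.mem_Ioc] at hn'; omega
        subst h0; simp]
    rw [hdrop] at hI
    have hterm : ∀ n ∈ Finset.Ioc 0 X, (2 * b - Real.log n) * (Λ n : ℝ) / 2
        ≤ (Λ n : ℝ) * ((2 * b - Real.log n) * (1 + 1 / n) / 2) := by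
      intro n hn
      rw [Finset.mem_Ioc] at hn
      have hn0 : (0 : ℝ) < n := by exact_mod_cast hn.1
      have hlog : Real.log n ≤ 2 * b := by
        rw [Real.log_le_iff_le_exp hn0]
        exact (Nat.cast_le.2 hn.2).trans (Nat.floor_le (Real.exp_pos _).le)
      have hΛ : 0 ≤ (Λ n : ℝ) := ArithmeticFunction.vonMangoldt_nonneg
      have h1n : 0 ≤ 1 / (n : ℝ) := by positivity
      nlinarith [mul_nonneg hΛ (mul_nonneg (by linarith : 0 ≤ 2 * b - Real.log n) h1n)]
    calc (E ^ 2 - 1 - (K * E * (2 * b) ^ 2 + M) * (2 * b)) / 2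
        ≤ (∑ n ∈ Finset.Ioc 0 X, (2 * b - Real.log n) * (Λ n : ℝ)) / 2 := by linarith
      _ = ∑ n ∈ Finset.Ioc 0 X, (2 * b - Real.log n) * (Λ n : ℝ) / 2 := by rw [Finset.sum_div]
      _ ≤ _ := Finset.sum_le_sum hterm
  -- assemble
  have hMl : E * (2 * b - 4) ≤ E * ∑ n ∈ Finset.Ioc 0 X, (Λ n : ℝ) / n := mul_le_mul_of_nonneg_left hMer hEpos.le
  have hψl : Real.exp (-b) * (∑ n ∈ Finset.Ioc 0 X, (Λ n : ℝ)) ≤ E + K * (2 * b) ^ 2 + M := by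
    refine (mul_le_mul_of_nonneg_left hψ hEinv0.le).trans ?_
    have e1 : Real.exp (-b) * (E ^ 2 + K * E * (2 * b) ^ 2 + M)
        = (Real.exp (-b) * E) * E + (Real.exp (-b) * E) * (K * (2 * b) ^ 2) + Real.exp (-b) * M := by ring
    rw [e1, hEinv, one_mul, one_mul]
    nlinarith
  -- the final step is linear in the named products
  have eW : (E ^ 2 - 1 - (K * E * (2 * b) ^ 2 + M) * (2 * b)) / 2
      = E ^ 2 / 2 - 1 / 2 - 4 * (K * b ^ 3 * E) - M * b := by ring
  have eψ : E + K * (2 * b) ^ 2 + M = E + 4 * (K * b ^ 2) + M := by ring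
  have eL : (E - C * (b ^ 3 + 1)) * (b + E / 2)
      = E * b + E ^ 2 / 2 - C * (b ^ 3 + 1) * b - C * (b ^ 3 + 1) * E / 2 := by ring
  rw [eW] at hW
  rw [eψ] at hψl
  rw [eL]
  linarith only [hMl, hψl, hW, p0, p1, p2, p3, p4, p5, hEpos, hb, hK, hM]

/-- **UNDER RH: the cosh quotient `R_c(b) = Q_b(χ_b)/(b + sinh b) ≥ e^b − C(b³ + 1)`** for all `b ≥ 1`. -/
theorem coshQuotient_ge_of_RH (hRH : RiemannHypothesis) :
    ∃ C : ℝ, 0 ≤ C ∧ ∀ b : ℝ, 1 ≤ b →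
      Real.exp b - C * (b ^ 3 + 1)
        ≤ primeShiftForm b ((Icc (-b) b).indicator (fun y ↦ Real.cosh (y / 2))) / (b + Real.sinh b) := by
  obtain ⟨C, hC, h⟩ := primeShiftForm_coshTest_ge_of_RH hRH
  refine ⟨C, hC, fun b hb ↦ ?_⟩
  have hP0 : 0 < b + Real.sinh b := by have := Real.sinh_pos_iff.2 (by linarith : 0 < b); linarith
  rw [le_div_iff₀ hP0]
  exact h b hb

/-! ## §3 The weight sum of a window -/

/-- **`Σ_{log n<2a} 2Λ(n)/√n ≤ 38(e^a + 1)`** (`FloorGrowth.sum_vonMangoldt_div_sqrt_le`: `Σ_{n<N}Λ/√n ≤ 19√N`). -/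
theorem weightSum_le (a : ℝ) :
    ∑ n ∈ weilPrimeIndex a, 2 * ((Λ n : ℝ) / Real.sqrt n) ≤ 38 * (Real.exp a + 1) := by
  set N := ⌊Real.exp (2 * a)⌋₊ + 1 with hN
  have hsub : weilPrimeIndex a ⊆ Finset.range N := Finset.filter_subset _ _
  have h1 : ∑ n ∈ weilPrimeIndex a, 2 * ((Λ n : ℝ) / Real.sqrt n) ≤ ∑ n ∈ Finset.range N, 2 * ((Λ n : ℝ) / Real.sqrt n) :=
    Finset.sum_le_sum_of_subset_of_nonneg hsub fun n _ _ ↦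
      mul_nonneg (by norm_num) (div_nonneg ArithmeticFunction.vonMangoldt_nonneg (Real.sqrt_nonneg _))
  refine h1.trans ?_
  rw [← Finset.mul_sum]
  have hs := FloorGrowth.sum_vonMangoldt_div_sqrt_le N
  have hNle : (N : ℝ) ≤ Real.exp (2 * a) + 1 := by
    rw [hN]; push_cast; linarith [Nat.floor_le (Real.exp_pos (2 * a)).le]
  have hsq : Real.sqrt N ≤ Real.exp a + 1 := by
    rw [Real.sqrt_le_iff]
    refine ⟨by positivity, hNle.trans ?_⟩
    have h2a : Real.exp (2 * a) = Real.exp a ^ 2 := by rw [← Real.exp_nat_mul]; norm_num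
    nlinarith [Real.exp_pos a]
  linarith

end FloorCoshSplit

end Summit.RiemannHypothesis.RiemannHypothesis.Theorems.WeilFormatC
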